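import Summits.MatrixMultiplication.OmegaCensus.STPPVosperTilingWordsPruned

/-!
# ω-census (abelian STPP census): a PAIRWISE-PRUNED block enumerator for the exact-cover checker with words, and its soundness (kernel)

HONEST FRAMING (pub-omega census; verbatim): lottery ticket; floor = certified bounds/negative ranges.
Census STRUCTURE (seat pub-omega-stpp-2 gen 26, 2026-08-28), family (b2).  A third instance of the sound-block-enumerator contract
`BlockEnumSound` (`STPPVosperTilingWordsEnum.lean`, seat stpp-1 gen 32), after `blockDiffsW` and the point-pruned `blockDiffsWP`
(`STPPVosperTilingWordsPruned.lean`).  MEASURED NEED: for the `ℤ₆₁` leaf `K3 = {(1,1,2),(2,3,3),(2,4,3),(3,3,2)}` (reading `(2,3,4)`, other blocks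
`(2,3,3), (3,2,3), (1,2,1)` against `17 + 16` points) one case-γ search through `blockDiffsWP` still exceeds the `decide +kernel` heartbeat ceiling: the
cost is the enumeration of the `(2,3,3)`- and `(3,2,3)`-candidates (`2.5–5.4·10⁶` mirror steps), `95 %` of it spent on assembling full `(C, B′, A)` triples and
their three difference lists although every within-block condition is UNARY or PAIRWISE in the elements of `A` once `(C, B)` is fixed.
`blockDiffsWQ` keeps `extC` (the point-by-point choice of `C` with candidate filtering) and then
* filters the `B′`-candidates by the unary part of `C − B` duplicate-freeness (`bOK`: `c − x` is not a point of `C = C − 0`),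
* for each `B′` passing the full `C − B` test, filters the `A`-candidates by the unary words (`aOK3` = `aOK` (W2) and the diagonal `a = a′` of W3),
* builds `A` as cliques of the PAIRWISE tests (`aPairOK`: cross duplicate-freeness of `C − A` and `A − B`, W1 in both orders, W3 off the diagonal in both
  orders) by the recursion `extA` (an element is admitted iff it is compatible with every element chosen before it),
* and re-tests every surviving triple with `blockTriple` exactly as `blockDiffsW`/`blockDiffsWP` do — so the OUTPUT CONTRACT is literally theirs:
`blockEnumSound_blockDiffsWQ : BlockEnumSound p (blockDiffsWQ p)`, and `existsCoverW_complete_enum` / `existsCoverW_of_isSTPP_enum` apply verbatim.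
Python mirror with step counter (identical candidate sets to `blockDiffsWP` on all K3 case-γ configurations and on K5; `(2,3,3)` against the K3 points:
`≈ 9·10⁴` steps instead of `3.8–5.4·10⁶`): HOME `pub-omega-stpp-2-g26/code/coverwq_mirror.py`.  UNCONDITIONAL.  Nothing here is progress on `ω`.

References: H. Cohn, R. Kleinberg, B. Szegedy, C. Umans, FOCS 2005 (arXiv:math/0511460), Def. 5.1.
-/

open Finset
open scoped Pointwise

namespace Summit.MatrixMultiplication.OmegaCensus.CubeNB

open Literature.Computability.AlgebraicComplexity
open Literature.Combinatorics.Additive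
open Summit.MatrixMultiplication.OmegaCensus.STPPKneser

/-! ## §1 The pairwise-pruned enumerator -/

section Checker

/-- Unary pre-test of a `B′`-candidate `x` once `C` is fixed: `(c − x) mod p` is not a point of `C` (the values `c′ − 0`), a part of the duplicate-freeness
of `C − B`. [folklore] -/
def bOK (p : ℕ) (C : List ℕ) (x : ℕ) : Bool := C.all fun c => !decide ((c + p - x) % p ∈ C)

/-- Unary pre-test of an `A`-candidate `x` once `C` and `B` are fixed: the within-block word W2 (`aOK`) and the diagonal `a = a′ = x` of W3,
`(c₁ − b) − (c₂ − x) ≠ x − b′` (`c₁ ≠ c₂`). [cite: CohnKleinbergSzegedyUmans2005, Def. 5.1] -/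
def aOK3 (p : ℕ) (ZL C B : List ℕ) (x : ℕ) : Bool :=
  aOK p ZL C B x &&
    C.all fun c₁ => C.all fun c₂ => decide (c₁ = c₂) || B.all fun b => B.all fun b' =>
      !decide (((c₁ + p - b) % p + p - (c₂ + p - x) % p) % p = (x + p - b') % p)

/-- Pairwise test of two distinct `A`-candidates `x, x′` once `C` and `B` are fixed: cross duplicate-freeness of `C − A` (`c − x ≠ c′ − x′`) and of
`A − B` (`x − b ≠ x′ − b′`), the word W1 in both orders (`(x − b) + (c − x′) ∉ YL`), and W3 off the diagonal in both orders
(`(c₁ − b) − (c₂ − x) ≠ x′ − b′`, `c₁ ≠ c₂`). [cite: CohnKleinbergSzegedyUmans2005, Def. 5.1] -/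
def aPairOK (p : ℕ) (YL C B : List ℕ) (x x' : ℕ) : Bool :=
  (C.all fun c => C.all fun c' => !decide ((c + p - x) % p = (c' + p - x') % p)) &&
  (B.all fun b => B.all fun b' => !decide ((x + p - b) % p = (x' + p - b') % p)) &&
  (B.all fun b => C.all fun c => !decide (((x + p - b) % p + (c + p - x') % p) % p ∈ YL) &&
    !decide (((x' + p - b) % p + (c + p - x) % p) % p ∈ YL)) &&
  (C.all fun c₁ => C.all fun c₂ => decide (c₁ = c₂) || B.all fun b => B.all fun b' =>
    !decide (((c₁ + p - b) % p + p - (c₂ + p - x) % p) % p = (x' + p - b') % p) &&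
    !decide (((c₁ + p - b) % p + p - (c₂ + p - x') % p) % p = (x + p - b') % p))

/-- **Clique extension.**  `extA ok rest k A`: all ways to extend the chosen list `A` by `k` more elements of `rest` (in order), an element `x` being
admitted iff `ok a x` for every `a` already chosen. [folklore] -/
def extA (ok : ℕ → ℕ → Bool) : List ℕ → ℕ → List ℕ → List (List ℕ)
  | [], k, A => if k = 0 then [A] else []
  | x :: rest, k, A =>
    match k with
    | 0 => [A]
    | k' + 1 => (if A.all fun a => ok a x then extA ok rest k' (A ++ [x]) else []) ++ extA ok rest (k' + 1) A

/-- **Pairwise-pruned block enumerator.**  Candidate value triples `(C − B, C − A, A − B)` of ONE block of sizes `(a, b, c)` — same output contract as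
`blockDiffsW` / `blockDiffsWP` (every output passes `blockTriple`), computed through `extC`, the unary pre-tests `bOK` / `aOK3` and the pairwise clique
recursion `extA` over `aPairOK`. [folklore] -/
def blockDiffsWQ (p : ℕ) (YL ZL : List ℕ) (a b c : ℕ) : List (List ℕ × List ℕ × List ℕ) :=
  (extC p YL ZL a (b - 1) YL c [] ((List.range p).filter fun x => x != 0) (List.range p)).flatMap fun T =>
    ((T.2.1.filter (bOK p T.1)).sublistsLen (b - 1)).flatMap fun B' =>
      if (diffList p T.1 (0 :: B')).Nodup then
        (extA (aPairOK p YL T.1 (0 :: B')) (T.2.2.filter (aOK3 p ZL T.1 (0 :: B'))) a []).filterMap fun A =>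
          blockTriple p YL ZL T.1 (0 :: B') A
      else []

end Checker

/-! ## §2 Soundness -/

section Sound

/-- `bOK` holds for a candidate satisfying its condition. [folklore] -/
theorem bOK_of_forall {p : ℕ} {C : List ℕ} {x : ℕ} (h : ∀ c ∈ C, (c + p - x) % p ∉ C) : bOK p C x = true := by
  rw [bOK, List.all_eq_true]
  intro c hc
  simpa using h c hc

/-- `aOK3` holds for a candidate satisfying the two unary words. [folklore] -/
theorem aOK3_of_forall {p : ℕ} {ZL C B : List ℕ} {x : ℕ}
    (h2 : ∀ b₁ ∈ B, ∀ b₂ ∈ B, b₁ ≠ b₂ → ∀ c ∈ C, ((c + p - b₁) % p + p - (x + p - b₂) % p) % p ∉ ZL)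
    (h3 : ∀ c₁ ∈ C, ∀ c₂ ∈ C, c₁ ≠ c₂ → ∀ b ∈ B, ∀ b' ∈ B, ((c₁ + p - b) % p + p - (c₂ + p - x) % p) % p ≠ (x + p - b') % p) :
    aOK3 p ZL C B x = true := by
  rw [aOK3, Bool.and_eq_true]
  refine ⟨aOK_of_forall h2, ?_⟩
  simp only [List.all_eq_true, Bool.or_eq_true, decide_eq_true_eq, Bool.not_eq_true', decide_eq_false_iff_not]
  intro c₁ hc₁ c₂ hc₂
  by_cases hc : c₁ = c₂
  · exact Or.inl hc
  · exact Or.inr fun b hb b' hb' => h3 c₁ hc₁ c₂ hc₂ hc b hb b' hb'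

/-- `aPairOK` holds for two candidates satisfying the pairwise conditions. [folklore] -/
theorem aPairOK_of_forall {p : ℕ} {YL C B : List ℕ} {x x' : ℕ}
    (hZ : ∀ c ∈ C, ∀ c' ∈ C, (c + p - x) % p ≠ (c' + p - x') % p)
    (hX : ∀ b ∈ B, ∀ b' ∈ B, (x + p - b) % p ≠ (x' + p - b') % p)
    (hW1 : ∀ b ∈ B, ∀ c ∈ C, ((x + p - b) % p + (c + p - x') % p) % p ∉ YL ∧ ((x' + p - b) % p + (c + p - x) % p) % p ∉ YL)
    (hW3 : ∀ c₁ ∈ C, ∀ c₂ ∈ C, c₁ ≠ c₂ → ∀ b ∈ B, ∀ b' ∈ B,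
      ((c₁ + p - b) % p + p - (c₂ + p - x) % p) % p ≠ (x' + p - b') % p ∧
        ((c₁ + p - b) % p + p - (c₂ + p - x') % p) % p ≠ (x + p - b') % p) :
    aPairOK p YL C B x x' = true := by
  rw [aPairOK]
  simp only [Bool.and_eq_true, List.all_eq_true, Bool.or_eq_true, decide_eq_true_eq, Bool.not_eq_true', decide_eq_false_iff_not]
  refine ⟨⟨⟨fun c hc c' hc' => hZ c hc c' hc', fun b hb b' hb' => hX b hb b' hb'⟩, fun b hb c hc => hW1 b hb c hc⟩,
    fun c₁ hc₁ c₂ hc₂ => ?_⟩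
  by_cases hc : c₁ = c₂
  · exact Or.inl hc
  · exact Or.inr fun b hb b' hb' => hW3 c₁ hc₁ c₂ hc₂ hc b hb b' hb'

/-- **`extA` reaches the real `A`.**  If the elements of `S` are pairwise `ok`, then from any chosen list `A` all of whose elements are `ok` with every
element of `S` in `rest` (`rest` duplicate-free), `extA ok rest #(S ∩ rest) A` returns, among others, `A` followed by the elements of `S` in the order of
`rest`. [folklore] -/
theorem mem_extA {ok : ℕ → ℕ → Bool} (S : Finset ℕ) (hS : ∀ x ∈ S, ∀ y ∈ S, x ≠ y → ok x y = true) :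
    ∀ (rest A : List ℕ), rest.Nodup → (∀ a ∈ A, ∀ x ∈ S, x ∈ rest → ok a x = true) →
      A ++ rest.filter (fun y => decide (y ∈ S)) ∈ extA ok rest (rest.filter fun y => decide (y ∈ S)).length A := by
  intro rest
  induction rest with
  | nil => intro A _ _; simp [extA]
  | cons y rest ih =>
    intro A hnd hA
    rw [List.nodup_cons] at hnd
    obtain ⟨hy, hnd'⟩ := hnd
    by_cases hyS : y ∈ S
    · have hf : (y :: rest).filter (fun z => decide (z ∈ S)) = y :: rest.filter (fun z => decide (z ∈ S)) := by simp [hyS]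
      rw [hf, List.length_cons]
      have hall : (A.all fun a => ok a y) = true := List.all_eq_true.2 fun a ha => hA a ha y hyS (by simp)
      simp only [extA, hall, ↓reduceIte, List.mem_append]
      left
      have h := ih (A ++ [y]) hnd' (fun a ha x hx hxr => by
        rw [List.mem_append, List.mem_singleton] at ha
        rcases ha with ha | rfl
        · exact hA a ha x hx (by simp [hxr])
        · exact hS _ hyS x hx (fun h => hy (h ▸ hxr)))
      rwa [List.append_assoc, List.singleton_append] at h
    · have hf : (y :: rest).filter (fun z => decide (z ∈ S)) = rest.filter (fun z => decide (z ∈ S)) := by simp [hyS]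
      rw [hf]
      rcases hk : (rest.filter fun z => decide (z ∈ S)).length with _ | k'
      · have hnil : rest.filter (fun z => decide (z ∈ S)) = [] := List.length_eq_zero_iff.1 hk
        rw [hnil]
        simp [extA]
      · simp only [extA, List.mem_append]
        right
        have h := ih A hnd' (fun a ha x hx hxr => hA a ha x hx (by simp [hxr]))
        rwa [hk] at h

/-- Membership in `blockDiffsWQ` (the witnesses spelled out). [folklore] -/
theorem mem_blockDiffsWQ {p : ℕ} {YL ZL : List ℕ} {a b c : ℕ} {C cB cA B' A : List ℕ}
    (hT : (C, cB, cA) ∈ extC p YL ZL a (b - 1) YL c [] ((List.range p).filter fun x => x != 0) (List.range p))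
    (hB : B' ∈ (cB.filter (bOK p C)).sublistsLen (b - 1))
    (hA : A ∈ extA (aPairOK p YL C (0 :: B')) (cA.filter (aOK3 p ZL C (0 :: B'))) a [])
    (h1 : (diffList p C (0 :: B')).Nodup) (h2 : (diffList p C A).Nodup) (h3 : (diffList p A (0 :: B')).Nodup)
    (hw : wordsIn p YL ZL C (0 :: B') A = true) :
    (diffList p C (0 :: B'), diffList p C A, diffList p A (0 :: B')) ∈ blockDiffsWQ p YL ZL a b c := by
  rw [blockDiffsWQ, List.mem_flatMap]
  refine ⟨(C, cB, cA), hT, ?_⟩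
  rw [List.mem_flatMap]
  refine ⟨B', hB, ?_⟩
  simp only [h1, if_true]
  rw [List.mem_filterMap]
  refine ⟨A, hA, ?_⟩
  simp [blockTriple, h1, h2, h3, hw]

/-- **`blockDiffsWQ` is a sound block enumerator.** [folklore] -/
theorem blockEnumSound_blockDiffsWQ (p : ℕ) : BlockEnumSound p (blockDiffsWQ p) := by
  intro YL ZL hYL a b c Av Bv Cv hszA hszB hszC hAp hBp hCp hB0 hY hZ hinjY hinjZ hinjX hw1 hw2 hw3
  -- the list realising C, in the order of YL
  have hCsub : ∀ x ∈ Cv, x ∈ YL := by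
    intro x hx
    have h := hY x hx 0 hB0
    rwa [Nat.sub_zero, Nat.add_mod_right, Nat.mod_eq_of_lt (hCp x hx)] at h
  set Cl := YL.filter (fun x => decide (x ∈ Cv)) with hCl
  have hClmem : ∀ x, x ∈ Cl ↔ x ∈ Cv := by
    intro x; rw [hCl, List.mem_filter, decide_eq_true_eq]; exact ⟨fun h => h.2, fun h => ⟨hCsub x h, h⟩⟩
  have hClnd : Cl.Nodup := hYL.filter _
  have hCllen : Cl.length = c := by rw [hCl, length_filter_mem_of_subset hYL hCsub, hszC]
  -- the pruned search reaches (Cl, cB*, cA*)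
  set cB₀ := (List.range p).filter (fun x => x != 0) with hcB₀
  set cA₀ := List.range p with hcA₀
  have hcB₀nd : cB₀.Nodup := (List.nodup_range).filter _
  have hcA₀nd : cA₀.Nodup := List.nodup_range
  have hsB₀ : ∀ x ∈ Bv.erase 0, x ∈ cB₀ := by
    intro x hx
    rw [Finset.mem_erase] at hx
    rw [hcB₀, List.mem_filter, List.mem_range]
    exact ⟨hBp x hx.2, by simpa using hx.1⟩
  have hsA₀ : ∀ x ∈ Av, x ∈ cA₀ := fun x hx => List.mem_range.2 (hAp x hx)
  have hYe : ∀ c' ∈ Cv, ∀ x ∈ Bv.erase 0, (c' + p - x) % p ∈ YL := fun c' hc' x hx => hY c' hc' x (Finset.mem_of_mem_erase hx)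
  have hext := mem_extC (YL := YL) (ZL := ZL) Cv (Bv.erase 0) Av (by rw [Finset.card_erase_of_mem hB0, hszB]) hszA hYe hZ
    YL [] cB₀ cA₀ hcB₀nd hcA₀nd hsB₀ hsA₀
  rw [List.nil_append, ← hCl, hCllen] at hext
  set cBf := keepAll p YL Cl cB₀ with hcBf
  set cAf := keepAll p ZL Cl cA₀ with hcAf
  have hBsub : ∀ x ∈ Bv.erase 0, x ∈ cBf := fun x hx =>
    mem_keepAll.2 ⟨hsB₀ x hx, fun y hy => hYe y ((hClmem y).1 hy) x hx⟩
  have hAsub : ∀ x ∈ Av, x ∈ cAf := fun x hx =>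
    mem_keepAll.2 ⟨hsA₀ x hx, fun y hy => hZ y ((hClmem y).1 hy) x hx⟩
  have hcBfnd : cBf.Nodup := nodup_keepAll hcB₀nd
  have hcAfnd : cAf.Nodup := nodup_keepAll hcA₀nd
  -- the B′-candidates passing the unary pre-test
  set cBg := cBf.filter (bOK p Cl) with hcBg
  have hBsubg : ∀ x ∈ Bv.erase 0, x ∈ cBg := by
    intro x hx
    rw [hcBg, List.mem_filter]
    refine ⟨hBsub x hx, bOK_of_forall fun c' hc' hmem => ?_⟩
    obtain ⟨hx0, hxB⟩ := Finset.mem_erase.1 hx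
    have heq : (c' + p - x) % p = ((c' + p - x) % p + p - 0) % p := by
      rw [Nat.sub_zero, Nat.add_mod_right, Nat.mod_mod]
    exact hx0 (hinjY c' ((hClmem _).1 hc') _ ((hClmem _).1 hmem) x hxB 0 hB0 heq).2
  have hcBgnd : cBg.Nodup := hcBfnd.filter _
  -- the list realising B′
  set Bl := cBg.filter (fun x => decide (x ∈ Bv.erase 0)) with hBl
  have hBlmem : ∀ x, x ∈ Bl ↔ x ∈ Bv.erase 0 := by
    intro x; rw [hBl, List.mem_filter, decide_eq_true_eq]; exact ⟨fun h => h.2, fun h => ⟨hBsubg x h, h⟩⟩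
  have hBlnd : Bl.Nodup := hcBgnd.filter _
  have hBllen : Bl.length = b - 1 := by
    rw [hBl, length_filter_mem_of_subset hcBgnd hBsubg, Finset.card_erase_of_mem hB0, hszB]
  have hB0l : ∀ x, x ∈ (0 :: Bl) ↔ x ∈ Bv := by
    intro x; rw [List.mem_cons, hBlmem, Finset.mem_erase]
    constructor
    · rintro (rfl | ⟨-, h⟩); exacts [hB0, h]
    · intro h; by_cases h0 : x = 0; exacts [Or.inl h0, Or.inr ⟨h0, h⟩]
  have hB0nd : (0 :: Bl).Nodup := by
    rw [List.nodup_cons]; refine ⟨fun h => ?_, hBlnd⟩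
    have := (hBlmem 0).1 h; simp at this
  -- the A-candidates passing the unary pre-tests
  set cAg := cAf.filter (aOK3 p ZL Cl (0 :: Bl)) with hcAg
  have hAsubg : ∀ x ∈ Av, x ∈ cAg := fun x hx => by
    rw [hcAg, List.mem_filter]
    exact ⟨hAsub x hx, aOK3_of_forall
      (fun b₁ hb₁ b₂ hb₂ hne c' hc' => hw2 b₁ ((hB0l _).1 hb₁) b₂ ((hB0l _).1 hb₂) hne c' ((hClmem _).1 hc') x hx)
      (fun c₁ hc₁ c₂ hc₂ hne y hy y' hy' =>
        hw3 c₁ ((hClmem _).1 hc₁) c₂ ((hClmem _).1 hc₂) hne y ((hB0l _).1 hy) x hx x hx y' ((hB0l _).1 hy'))⟩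
  have hcAgnd : cAg.Nodup := hcAfnd.filter _
  set Al := cAg.filter (fun x => decide (x ∈ Av)) with hAl
  have hAlmem : ∀ x, x ∈ Al ↔ x ∈ Av := by
    intro x; rw [hAl, List.mem_filter, decide_eq_true_eq]; exact ⟨fun h => h.2, fun h => ⟨hAsubg x h, h⟩⟩
  have hAlnd : Al.Nodup := hcAgnd.filter _
  have hAllen : Al.length = a := by rw [hAl, length_filter_mem_of_subset hcAgnd hAsubg, hszA]
  -- the real A is a clique of the pairwise tests, reached by extA
  have hpair : ∀ x ∈ Av, ∀ x' ∈ Av, x ≠ x' → aPairOK p YL Cl (0 :: Bl) x x' = true := fun x hx x' hx' hne =>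
    aPairOK_of_forall
      (fun c₁ hc₁ c₂ hc₂ heq => hne (hinjZ c₁ ((hClmem _).1 hc₁) c₂ ((hClmem _).1 hc₂) x hx x' hx' heq).2)
      (fun y hy y' hy' heq => hne (hinjX x hx x' hx' y ((hB0l _).1 hy) y' ((hB0l _).1 hy') heq).1)
      (fun y hy c₁ hc₁ => ⟨hw1 x hx x' hx' hne y ((hB0l _).1 hy) c₁ ((hClmem _).1 hc₁),
        hw1 x' hx' x hx (Ne.symm hne) y ((hB0l _).1 hy) c₁ ((hClmem _).1 hc₁)⟩)
      (fun c₁ hc₁ c₂ hc₂ hne' y hy y' hy' =>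
        ⟨hw3 c₁ ((hClmem _).1 hc₁) c₂ ((hClmem _).1 hc₂) hne' y ((hB0l _).1 hy) x hx x' hx' y' ((hB0l _).1 hy'),
          hw3 c₁ ((hClmem _).1 hc₁) c₂ ((hClmem _).1 hc₂) hne' y ((hB0l _).1 hy) x' hx' x hx y' ((hB0l _).1 hy')⟩)
  have hextA : Al ∈ extA (aPairOK p YL Cl (0 :: Bl)) cAg a [] := by
    have h := mem_extA (ok := aPairOK p YL Cl (0 :: Bl)) Av hpair cAg [] hcAgnd (fun a ha => by simp at ha)
    rw [List.nil_append, ← hAl, hAllen] at h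
    exact h
  -- the three difference lists are duplicate-free
  have hn1 : (diffList p Cl (0 :: Bl)).Nodup := nodup_diffList hClnd hB0nd fun c₁ hc₁ c₂ hc₂ x₁ hx₁ x₂ hx₂ h =>
    hinjY c₁ ((hClmem _).1 hc₁) c₂ ((hClmem _).1 hc₂) x₁ ((hB0l _).1 hx₁) x₂ ((hB0l _).1 hx₂) h
  have hn2 : (diffList p Cl Al).Nodup := nodup_diffList hClnd hAlnd fun c₁ hc₁ c₂ hc₂ x₁ hx₁ x₂ hx₂ h =>
    hinjZ c₁ ((hClmem _).1 hc₁) c₂ ((hClmem _).1 hc₂) x₁ ((hAlmem _).1 hx₁) x₂ ((hAlmem _).1 hx₂) h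
  have hn3 : (diffList p Al (0 :: Bl)).Nodup := nodup_diffList hAlnd hB0nd fun c₁ hc₁ c₂ hc₂ x₁ hx₁ x₂ hx₂ h =>
    hinjX c₁ ((hAlmem _).1 hc₁) c₂ ((hAlmem _).1 hc₂) x₁ ((hB0l _).1 hx₁) x₂ ((hB0l _).1 hx₂) h
  -- the within-block words
  have hw : wordsIn p YL ZL Cl (0 :: Bl) Al = true := by
    refine wordsIn_of_forall (fun a₁ ha₁ a₂ ha₂ hne y hy c' hc' => ?_) (fun b₁ hb₁ b₂ hb₂ hne c' hc' x hx => ?_)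
      (fun c₁ hc₁ c₂ hc₂ hne y hy x hx hmem => ?_)
    · exact hw1 a₁ ((hAlmem _).1 ha₁) a₂ ((hAlmem _).1 ha₂) hne y ((hB0l _).1 hy) c' ((hClmem _).1 hc')
    · exact hw2 b₁ ((hB0l _).1 hb₁) b₂ ((hB0l _).1 hb₂) hne c' ((hClmem _).1 hc') x ((hAlmem _).1 hx)
    · obtain ⟨x', hx', y', hy', h⟩ := mem_diffList.1 hmem
      exact hw3 c₁ ((hClmem _).1 hc₁) c₂ ((hClmem _).1 hc₂) hne y ((hB0l _).1 hy) x ((hAlmem _).1 hx) x' ((hAlmem _).1 hx')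
        y' ((hB0l _).1 hy') h.symm
  exact ⟨Al, 0 :: Bl, Cl, hAlmem, hB0l, hClmem, mem_blockDiffsWQ hext (List.mem_sublistsLen.2 ⟨List.filter_sublist, hBllen⟩) hextA
    hn1 hn2 hn3 hw⟩

end Sound

end Summit.MatrixMultiplication.OmegaCensus.CubeNB
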